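import Summits.BirchSwinnertonDyer.BirchSwinnertonDyer.Theorems.Rank2ObservatoryCertificate
import HarnessLib

/-!
# BirchSwinnertonDyer — rank ≥ 2 observatory: kernel re-count of `#Ẽ(𝔽_p)`

HONEST FRAMING: per-curve certified theorems and census instruments; no claim on BSD in rank ≥ 2.

Both engines of the observatory compute, for every curve and every small good prime `p`, the
number of points `#Ẽ(𝔽_p) = p + 1 − a_p` of the reduced minimal model by direct enumeration
(engine P: PARI `ellap` cross-checked against a naive count; engine B: stdlib enumeration). These
counts carry the certificate's torsion bound (`#E(ℚ)_tors ∣ gcd_l #Ẽ(𝔽_l)`, `TORSION_INJECTS`) and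
its independence witnesses (images of the listed generators in `Ẽ(𝔽_q)`). The per-curve files
re-count them a THIRD time, inside the Lean kernel: `affinePointCount p a₁ a₂ a₃ a₄ a₆` below is
the number of affine solutions `(x, y) ∈ {0,…,p−1}²` of the Weierstrass congruence
`y² + a₁xy + a₃y ≡ x³ + a₂x² + a₄x + a₆ (mod p)`, a closed computable term evaluated by `decide`
(kernel reduction; no `native_decide`, no extra axioms), so that `affinePointCount p … + 1` is the
engines' `#Ẽ(𝔽_p)` for a prime `p` of good reduction. Its identification with Mathlib's
`Fintype.card` of the point type of `W.map (Int.castRingHom (ZMod p))` is NOT formalised here (it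
is the definition of that finite type unfolded; recorded as data, not claimed as a theorem).

Reference: J. E. Cremona, *Algorithms for Modular Elliptic Curves* (2nd ed. 1997), §2.4 and §3.5
(`a_p` by point counting; torsion bound from `#Ẽ(𝔽_p)`).
-/

-- single-conjunct summit: `Summit.BirchSwinnertonDyer.BirchSwinnertonDyer.…` repeats the name by design
set_option linter.dupNamespace false

namespace Summit.BirchSwinnertonDyer.BirchSwinnertonDyer.Rank2Observatory

/-- The number of affine solutions `(x, y) ∈ {0, …, p−1}²` of
`y² + a₁xy + a₃y ≡ x³ + a₂x² + a₄x + a₆ (mod p)` (integer coefficients, any modulus `p ≥ 1`);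
for a prime `p` of good reduction `#Ẽ(𝔽_p) = affinePointCount p a₁ a₂ a₃ a₄ a₆ + 1` (the point at
infinity). Computable; meant for kernel evaluation by `decide` (Cremona 1997 §2.4). [folklore] -/
def affinePointCount (p : ℕ) (a₁ a₂ a₃ a₄ a₆ : ℤ) : ℕ :=
  ((List.range p).map fun x : ℕ =>
    ((List.range p).filter fun y : ℕ =>
      (((y : ℤ) ^ 2 + a₁ * x * y + a₃ * y) - ((x : ℤ) ^ 3 + a₂ * (x : ℤ) ^ 2 + a₄ * x + a₆))
        % (p : ℤ) = 0).length).sum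

/-- Sanity check of the counter on `y² + y = x³ − x` (`37a1`) modulo `2`: the affine solutions are
`(0,0), (0,1), (1,0), (1,1)`, so `#Ẽ(𝔽₂) = 5` and `a₂ = −2` (Cremona's table). [folklore] -/
theorem affinePointCount_37a1_two : affinePointCount 2 0 0 1 (-1) 0 = 4 := by decide +kernel

/-- `389a1 : y² + y = x³ + x² − 2x` modulo `11`: `15` affine points, `#Ẽ(𝔽₁₁) = 16`, `a₁₁ = −4`
(both engines; Cremona's table). [folklore] -/
theorem affinePointCount_389a1_eleven : affinePointCount 11 0 1 1 (-2) 0 = 15 := by decide +kernel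

/-- `389a1` modulo `59`: `56` affine points, `#Ẽ(𝔽₅₉) = 57`, `a₅₉ = 3` (both engines; Cremona's
table) — the largest modulus used by the per-curve files, as a cost gauge. [folklore] -/
theorem affinePointCount_389a1_fiftynine : affinePointCount 59 0 1 1 (-2) 0 = 56 := by
  decide +kernel

end Summit.BirchSwinnertonDyer.BirchSwinnertonDyer.Rank2Observatory
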